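import Mathlib
import Summits.ValiantsHypothesis.ValiantsHypothesis.Theses.PrincipalMinorColouring
import Summits.ValiantsHypothesis.ValiantsHypothesis.Theorems.PrincipalMinorColouringPMReprIsDetRepr

/-!
# Route `PrincipalMinorColouring`, support item `TotalRankNotQPOfConstantsSeam` (stmt-ValiantsHypothesis-18099)

The glue of the CONSTANTS-seam split of the deciding crux `TotalRankNotQP`
(stmt-ValiantsHypothesis-3775):

  `ConstantEliminationQP → ConstantFreePerNotQP → TotalRankNotQP`.

Proof.  Were every `per_n(x+J)` principal-minor representable in size `R_n ≤ 2^((log₂ n + c)^c)`,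
the landed support `PMReprIsDetRepr` (`pmReprIsDetRepr_proof`) would give an affine determinantal
representation of `per_n` over `ℂ` of size `R_n`; `ConstantEliminationQP` would give a nonzero
integer `N_n` and a constant-free circuit for `N_n · PER_n` of size
`≤ 2^((log₂ R_n + a)^a) ≤ 2^((log₂ n + c')^{c'})` with `c' = (c+2)(a+1)`
(`constantsSeam_qp_exponent_comp`, composition of two quasi-polynomial bounds); choosing such an
`N_n` for every `n` gives a nonzero multiplier sequence along which `τ(N_n · PER_n)` is
quasi-polynomially bounded, contradicting `ConstantFreePerNotQP`.

(Landed from the crux strategist's candidate `Cruxes/TotalRankNotQP/Lines/constants_seam.lean`.)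

References: P. Bürgisser, *Completeness and Reduction in Algebraic Complexity Theory* (2000),
Def. 2.26 (quasi-polynomial bounds); folklore.
-/

set_option linter.dupNamespace false

open Literature.Computability.AlgebraicComplexity

namespace Summit.ValiantsHypothesis.ValiantsHypothesis.Theorems

/-- **Composition of two quasi-polynomial bounds, at the level of exponents.** If
`t ≤ (L + c)^c` then `(t + a)^a ≤ (L + c')^{c'}` with `c' = (c + 2)(a + 1)`; used with
`L = log₂ n`, `t = log₂ R`: a quantity quasi-polynomial in `R` is quasi-polynomial in `n` when
`R` is. [folklore] -/
theorem constantsSeam_qp_exponent_comp (a c L t : ℕ) (ht : t ≤ (L + c) ^ c) :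
    (t + a) ^ a ≤ (L + (c + 2) * (a + 1)) ^ ((c + 2) * (a + 1)) := by
  set c' := (c + 2) * (a + 1) with hc'
  set u := L + c' with hu
  have hc'2 : 2 ≤ c' := by
    have : (c + 2) * (a + 1) ≥ (0 + 2) * (0 + 1) := Nat.mul_le_mul (by omega) (by omega)
    omega
  have hcc' : c ≤ c' := by
    have : (c + 2) * (a + 1) ≥ (c + 2) * 1 := Nat.mul_le_mul_left _ (by omega)
    omega
  have hac' : a ≤ c' := by
    have : (c + 2) * (a + 1) ≥ 1 * (a + 1) := Nat.mul_le_mul_right _ (by omega)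
    omega
  have hu2 : 2 ≤ u := le_add_left hc'2
  have hu1 : 1 ≤ u := le_trans (by norm_num) hu2
  have hLc : L + c ≤ u := Nat.add_le_add_left hcc' L
  have hau : a ≤ u := le_add_left hac'
  have h1 : t + a ≤ u ^ (c + 2) := by
    calc t + a ≤ (L + c) ^ c + a := Nat.add_le_add_right ht a
      _ ≤ u ^ c + u := Nat.add_le_add (Nat.pow_le_pow_left hLc c) hau
      _ ≤ u ^ (c + 1) + u ^ (c + 1) :=
          Nat.add_le_add (Nat.pow_le_pow_right hu1 (Nat.le_succ c))
            (by simpa using Nat.pow_le_pow_right hu1 (show 1 ≤ c + 1 by omega))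
      _ = 2 * u ^ (c + 1) := by ring
      _ ≤ u * u ^ (c + 1) := Nat.mul_le_mul_right _ hu2
      _ = u ^ (c + 2) := by ring
  calc (t + a) ^ a ≤ (u ^ (c + 2)) ^ a := Nat.pow_le_pow_left h1 a
    _ = u ^ ((c + 2) * a) := by rw [← pow_mul]
    _ ≤ u ^ c' := Nat.pow_le_pow_right hu1 (by rw [hc']; exact Nat.mul_le_mul_left _ (Nat.le_succ a))

/-- A size bound `R ≤ 2^B` bounds the binary logarithm: `log₂ R ≤ B`. [folklore] -/
theorem constantsSeam_log_two_le_of_le_two_pow {R B : ℕ} (hR : R ≤ 2 ^ B) : Nat.log 2 R ≤ B := by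
  calc Nat.log 2 R ≤ Nat.log 2 (2 ^ B) := Nat.log_mono_right hR
    _ = B := Nat.log_pow (by norm_num) B

/-- **Item `TotalRankNotQPOfConstantsSeam` (stmt-ValiantsHypothesis-18099), the constants seam of
`TotalRankNotQP`** (route PrincipalMinorColouring, deciding crux stmt-ValiantsHypothesis-3775):
`ConstantEliminationQP → ConstantFreePerNotQP → TotalRankNotQP`.
Were every `per_n(x+J)` principal-minor representable in size `R_n ≤ 2^((log₂ n + c)^c)`, the
landed support `PMReprIsDetRepr` would give `dc_ℂ(per_n) ≤ R_n`, `ConstantEliminationQP` would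
give nonzero `N_n` with `τ(N_n · PER_n) ≤ 2^((log₂ R_n + a)^a) ≤ 2^((log₂ n + c')^{c'})`,
`c' = (c+2)(a+1)` (`constantsSeam_qp_exponent_comp`), and `ConstantFreePerNotQP` applied to the
chosen sequence `N` is contradicted. [cite: Burgisser2000, Def. 2.26] [folklore] -/
theorem totalRankNotQPOfConstantsSeam_proof :
    Summit.ValiantsHypothesis.ValiantsHypothesis.Theses.PrincipalMinorColouring.TotalRankNotQPOfConstantsSeam := by
  unfold Summit.ValiantsHypothesis.ValiantsHypothesis.Theses.PrincipalMinorColouring.TotalRankNotQPOfConstantsSeam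
    Summit.ValiantsHypothesis.ValiantsHypothesis.Theses.PrincipalMinorColouring.ConstantEliminationQP
    Summit.ValiantsHypothesis.ValiantsHypothesis.Theses.PrincipalMinorColouring.ConstantFreePerNotQP
    Summit.ValiantsHypothesis.ValiantsHypothesis.Theses.PrincipalMinorColouring.TotalRankNotQP
  rintro ⟨a, ha⟩ hA c
  by_contra hX
  push Not at hX
  -- `hX : ∀ n, ∃ R ≤ 2 ^ ((log₂ n + c) ^ c), ∃ K κ, per_n(x+J) = n! · det(1 + diag(x∘κ)·K)`
  choose R hR K κ hrepr using hX
  -- each principal-minor representation is an affine determinantal representation of size `R n`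
  have hdet : ∀ n, HasDetRepr (perPoly (Fin n) ℂ) (R n) := fun n =>
    pmReprIsDetRepr_proof n (R n) (K n) (κ n) (hrepr n)
  -- constant elimination at scale `R n`, with its multiplier `N n ≠ 0`
  choose N hN0 hNτ using fun n => ha n (R n) (hdet n)
  -- the chosen multiplier sequence has qp-bounded `τ(N_n · PER_n)`: contradiction
  refine hA N hN0 ⟨(c + 2) * (a + 1), fun n => ?_⟩
  calc constantFreeComplexity (MvPolynomial.C (N n) * perPoly (Fin n) ℤ)
        ≤ 2 ^ ((Nat.log 2 (R n) + a) ^ a) := hNτ n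
    _ ≤ 2 ^ ((Nat.log 2 n + (c + 2) * (a + 1)) ^ ((c + 2) * (a + 1))) :=
        Nat.pow_le_pow_right (by norm_num)
          (constantsSeam_qp_exponent_comp a c (Nat.log 2 n) (Nat.log 2 (R n))
            (constantsSeam_log_two_le_of_le_two_pow (hR n)))

end Summit.ValiantsHypothesis.ValiantsHypothesis.Theorems
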